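import Summits.BirchSwinnertonDyer.BirchSwinnertonDyer.Theorems.AlignedTransportAtTwoMainConjectureOfRankZeroBSDAtTwoHalfDescentLayerIndexGrowthFiniteTwistOrbit
import Summits.BirchSwinnertonDyer.BirchSwinnertonDyer.Theorems.AlignedTransportAtTwoMainConjectureOfRankZeroBSDAtTwoHalfDescentLayerIndexGrowthFiniteCompleteTwo
import HarnessLib

/-!
# Route `AlignedTransportAtTwo`, crux C2 `MainConjectureOfRankZeroBSDAtTwo` (stmt-BirchSwinnertonDyer-22298):
# THE `μ`-BOUND ON THE CURVE ITSELF, SEED-CELL FORM — on good ORDINARY `2` (the seed cell) the two control kernels in `2^{μ₂} ∣ #Sel_{2^∞}(E/ℚ)·#ker g_0(E)·#ker g_1(E)` are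
# FINITE AND POSITIVE (Greenberg's Lemma 3.5 at `2`, tree), so `μ₂(X(E/ℚ_∞)) ≤ v₂(#Sel_{2^∞}(E/ℚ) · c(E))` with `0 < c(E) = #ker g_0(E)·#ker g_1(E) ≤ C(E)²` — an answer to REF2's vacuity flag
# (P-att5-59, 22:19Z/22:37Z): the bound carries information exactly where `X` can be torsion, and reads `∣ 0` only through `#Sel_{2^∞}(E/ℚ)` (rank `> 0` or infinite `Ш[2^∞]`)

HONEST FRAMING (cell `bsd-f1-sign2`, WIDTH-5 attached prover seat `bsd-line-att-p5` gen 59 on line `birth` of the lead `bsd-line-att-p2`;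
`--supports` stmt-BirchSwinnertonDyer-22298, closes nothing; BSD is NOT proved by any of this; the crux C2, its verdict «blocked-on
`Rank1Residual.GreenbergMuConjectureIrreducible`» and every registered stub (P / T / Kμ / LimDoor / MuIneqʳ / PFμ⁺) are untouched). THEOREMS ONLY — no `def`,
no instance, no named fact, no `sorry`. Sequel of this gen's `…GrowthFiniteTwistOrbit` (`pow_mu_dvd_natCard_selmerLayer_zero_mul_kerG_zero_mul_kerG_one`) and of gen 57's
`…GrowthFiniteCompleteTwo.exists_forall_natCard_kerG_pos_le_two` (`∃ C, ∀ n, 0 < #ker g_n(E) ≤ C` for `E/ℚ` globally minimal, good ordinary at `2`, `κ` cyclotomic — Greenberg's Lemma 3.5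
at `2`, KERNEL in cell bsd-2adic). REF2's flag (STATUS 22:19Z/22:37Z): at a (potentially) SUPERSINGULAR prime above `2` Greenberg's kernels are INFINITE (`Im κ` fills `H¹` over the deeply
ramified local tower), so `Nat.card`-divisibilities through `#ker g` read `∣ 0` there — agreed; those curves also violate «`X` torsion». This file records the informative case.

THE POINT. ★★★ `seedMu_bound`: for `E/ℚ` elliptic, globally minimal, good ordinary at `2`, no rational `2`-torsion abscissa, `κ` cyclotomic with topological generator `γ`, and every
Pontryagin-dual datum `D` with `X` f.g. torsion: **`2^{μ(D)} ∣ #Sel_{2^∞}(E/ℚ) · (#ker g_0(E)·#ker g_1(E))` with `0 < #ker g_0(E)·#ker g_1(E) ≤ C²`** (`C` Greenberg's bound); hence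
★★ if `Sel_{2^∞}(E/ℚ)` is finite (rank `0` and `Ш[2^∞]` finite — PRINT for the `r_an = 0` seeds) then **`2^{μ₂} ≤ #Sel_{2^∞}(E/ℚ)·#ker g_0(E)·#ker g_1(E)`**, i.e. `μ₂ ≤ log₂` of three
finite base-level numbers; ★★ WITHOUT any reduction hypothesis: **`#Sel_{2^∞}(E/ℚ)·#ker g_0(E)·#ker g_1(E)` odd ⟹ `μ₂(X(E/ℚ_∞)) = 0`** (`mu_eq_zero_of_odd`). (For ordinary `2`, `2` is always
anomalous — `#Ẽ(𝔽₂) ∈ {2, 4}` — so in print `#ker g_1(E)` is even and the odd-door is shut on the seed cell; the content is the BOUND.) Nothing numerical is asserted; C2 untouched.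
Memo `Cruxes/MainConjectureOfRankZeroBSDAtTwo/RELAXED-PREIMAGE-att-p5-g59.md`.

References: R. Greenberg, LNM 1716 (1999), §1 Conj. 1.11, §3 Lemmas 3.3–3.5 (p. 86–90), §4 Thm. 4.1, Lemma 4.3 [GreenbergLNM1716]; J. Coates, R. Greenberg, Invent. Math. 124 (1996) (deeply
ramified: `Im κ` at supersingular primes) [CoatesGreenberg1996]; L. Washington, GTM 83, §13.3 Thm. 13.13 [Washington1997].
-/

set_option linter.dupNamespace false
set_option autoImplicit false

noncomputable section

open scoped Classical

namespace Summit.BirchSwinnertonDyer.BirchSwinnertonDyer.Theorems.AlignedTransportAtTwoHalfDescentLayerIndexGrowthFiniteTwistOrbitSeed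

open WeierstrassCurve Literature.NumberTheory.EllipticCurves Literature.NumberTheory.EllipticCurves.Greenberg1999
  Summit.BirchSwinnertonDyer.BirchSwinnertonDyer.Theorems
  Summit.BirchSwinnertonDyer.BirchSwinnertonDyer.Theorems.AlignedTransportAtTwoHalfDescentLayerIndexGrowthFiniteCompleteTwo
  Summit.BirchSwinnertonDyer.BirchSwinnertonDyer.Theorems.AlignedTransportAtTwoHalfDescentLayerIndexGrowthFiniteTwistOrbit

section Seed

variable (W : WeierstrassCurve ℚ) [W.IsElliptic] (κ : ZpExtension ℚ 2) {γ : Field.absoluteGaloisGroup ℚ}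

/-- ★★ REDUCTION-FREE ODD DOOR: **`#Sel_{2^∞}(E/ℚ) · #ker g_0(E) · #ker g_1(E)` odd ⟹ `μ(X(E/ℚ_∞)) = 0`** for every elliptic `E/ℚ` without a rational `2`-torsion abscissa, `κ` cyclotomic, `X` f.g.
torsion (`2^μ` divides an odd number). [cite: GreenbergLNM1716, Conj. 1.11, §3, §4 Lemma 4.3] -/
theorem mu_eq_zero_of_odd (hκ : κ.IsCyclotomic) (hγ : κ.IsTopGenerator γ) (ht : ∀ x : ℚ, ¬ HasRationalTwoTorsionX W x)
    (D : W.SelmerDualData κ γ) [Module.Finite (IwasawaAlgebra 2) D.X] (hD : D.IsTorsion)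
    (hodd : Odd (Nat.card (W.selmerLayer κ 0) * Nat.card (W.KerG κ 0) * Nat.card (W.KerG κ 1))) : D.mu = 0 := by
  have h := pow_mu_dvd_natCard_selmerLayer_zero_mul_kerG_zero_mul_kerG_one W κ hκ hγ ht D hD
  by_contra hμ
  have h2 : 2 ∣ Nat.card (W.selmerLayer κ 0) * Nat.card (W.KerG κ 0) * Nat.card (W.KerG κ 1) :=
    (dvd_pow_self 2 hμ).trans h
  exact (Nat.not_even_iff_odd.mpr hodd) (even_iff_two_dvd.mpr h2)

variable [W.IsGloballyMinimal]

/-- ★★★ **THE `μ`-BOUND ON THE SEED CELL, WITH FINITE POSITIVE KERNELS.** `E/ℚ` elliptic, globally minimal, good ordinary at `2`, no rational `2`-torsion abscissa; `κ` cyclotomic with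
topological generator `γ`; `D` any Pontryagin-dual datum with `X` f.g. torsion. Then **`2^{μ(D)} ∣ #Sel_{2^∞}(E/ℚ) · (#ker g_0(E) · #ker g_1(E))`** and, for Greenberg's bound `C` of Lemma 3.5
at `2` (tree), **`0 < #ker g_0(E) · #ker g_1(E) ≤ C · C`** — the kernel factors are honest finite positive numbers; only `#Sel_{2^∞}(E/ℚ)` may be infinite (`Nat.card 0`: rank `> 0` or
infinite `Ш[2^∞]`). [cite: GreenbergLNM1716, Conj. 1.11, §3 Lemmas 3.3–3.5, §4 Lemma 4.3] -/
theorem pow_mu_dvd_and_kerG_pos_le (hord : IsOrdinaryAt W 2) (hκ : κ.IsCyclotomic) (hγ : κ.IsTopGenerator γ) (ht : ∀ x : ℚ, ¬ HasRationalTwoTorsionX W x)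
    (D : W.SelmerDualData κ γ) [Module.Finite (IwasawaAlgebra 2) D.X] (hD : D.IsTorsion) :
    ∃ C : ℕ, 2 ^ D.mu ∣ Nat.card (W.selmerLayer κ 0) * (Nat.card (W.KerG κ 0) * Nat.card (W.KerG κ 1)) ∧
      0 < Nat.card (W.KerG κ 0) * Nat.card (W.KerG κ 1) ∧ Nat.card (W.KerG κ 0) * Nat.card (W.KerG κ 1) ≤ C * C := by
  obtain ⟨C, hC⟩ := exists_forall_natCard_kerG_pos_le_two W κ hord hκ
  refine ⟨C, ?_, Nat.mul_pos (hC 0).1 (hC 1).1, Nat.mul_le_mul (hC 0).2 (hC 1).2⟩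
  rw [← mul_assoc]
  exact pow_mu_dvd_natCard_selmerLayer_zero_mul_kerG_zero_mul_kerG_one W κ hκ hγ ht D hD

/-- ★★ **`2^{μ₂} ≤ #Sel_{2^∞}(E/ℚ) · #ker g_0(E) · #ker g_1(E)`** on the seed cell whenever `Sel_{2^∞}(E/ℚ)` is finite (rank `0`, `Ш(E)[2^∞]` finite): `μ₂(X(E/ℚ_∞))` is at most the `2`-logarithm of
three finite base-level invariants of `E` — the `2^∞`-Selmer group over `ℚ` and Greenberg's control kernels at `ℚ` and `ℚ(√2)`. [cite: GreenbergLNM1716, Conj. 1.11, §3 Lemmas 3.3–3.5, §4 Thm. 4.1, Lemma 4.3] -/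
theorem two_pow_mu_le (hord : IsOrdinaryAt W 2) (hκ : κ.IsCyclotomic) (hγ : κ.IsTopGenerator γ) (ht : ∀ x : ℚ, ¬ HasRationalTwoTorsionX W x)
    (D : W.SelmerDualData κ γ) [Module.Finite (IwasawaAlgebra 2) D.X] (hD : D.IsTorsion) [Finite (W.selmerLayer κ 0)] :
    0 < Nat.card (W.selmerLayer κ 0) * Nat.card (W.KerG κ 0) * Nat.card (W.KerG κ 1) ∧
      2 ^ D.mu ≤ Nat.card (W.selmerLayer κ 0) * Nat.card (W.KerG κ 0) * Nat.card (W.KerG κ 1) := by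
  obtain ⟨C, hdvd, hpos, -⟩ := pow_mu_dvd_and_kerG_pos_le W κ hord hκ hγ ht D hD
  have hpos' : 0 < Nat.card (W.selmerLayer κ 0) * Nat.card (W.KerG κ 0) * Nat.card (W.KerG κ 1) := by
    rw [mul_assoc]
    exact Nat.mul_pos Nat.card_pos hpos
  refine ⟨hpos', Nat.le_of_dvd hpos' ?_⟩
  rw [mul_assoc]
  exact hdvd

/-- ★★ Logarithmic form: **`μ₂(X(E/ℚ_∞)) ≤ log₂(#Sel_{2^∞}(E/ℚ) · #ker g_0(E) · #ker g_1(E))`** on the seed cell with `Sel_{2^∞}(E/ℚ)` finite. [cite: GreenbergLNM1716, Conj. 1.11, §3, §4 Lemma 4.3] -/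
theorem mu_le_log (hord : IsOrdinaryAt W 2) (hκ : κ.IsCyclotomic) (hγ : κ.IsTopGenerator γ) (ht : ∀ x : ℚ, ¬ HasRationalTwoTorsionX W x)
    (D : W.SelmerDualData κ γ) [Module.Finite (IwasawaAlgebra 2) D.X] (hD : D.IsTorsion) [Finite (W.selmerLayer κ 0)] :
    D.mu ≤ Nat.log 2 (Nat.card (W.selmerLayer κ 0) * Nat.card (W.KerG κ 0) * Nat.card (W.KerG κ 1)) := by
  obtain ⟨-, hle⟩ := two_pow_mu_le W κ hord hκ hγ ht D hD
  exact Nat.le_log_of_pow_le (by norm_num) hle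

end Seed

end Summit.BirchSwinnertonDyer.BirchSwinnertonDyer.Theorems.AlignedTransportAtTwoHalfDescentLayerIndexGrowthFiniteTwistOrbitSeed

end
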